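import Literature.Probability.RandomPlanarGeometry.PlanarDomains

/-!
# Stub `stub_localToGlobal` of line `excursion-kernel-covariance`, piece (P2): uniform flat radius
# (crux `RectilinearCardy`, stmt-CriticalPhenomena-5660, route `CardyBoundaryCoulombGas`)

If every point `R.boundary s`, `s ∈ [σ, σ']`, of the boundary arc of a conformal rectangle `R` is
a FLAT point (the frontier near it lies on the horizontal, or on the vertical, line through it, at
some radius `r_s > 0`), then one radius `r > 0` works for all `s ∈ [σ, σ']` simultaneously.

Proof: flatness at `z` with radius `r` is inherited, with radius `r / 2`, by every frontier point
`z'` with `dist z' z < r / 2` (triangle inequality; the line through `z'` is the line through `z`).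
The parameter interval `[σ, σ']` is compact and `R.boundary` is continuous, so finitely many of the
open sets `{t | dist (R.boundary t) (R.boundary s) < r_s / 2}` cover it; the minimum of the finitely
many `r_{s_i} / 2` is the uniform radius.
-/

noncomputable section

open Set Filter Topology

namespace Summit.CriticalPhenomena.CardyFormulaZ2.Cruxes.RectilinearCardy.ExcursionKernelCovariance

open Literature.Probability.RandomPlanarGeometry

/-- **Uniform flat radius on a compact parameter interval.** If the frontier of the conformal
rectangle `R` is flat (horizontal or vertical) near each boundary point `R.boundary s`,
`s ∈ [σ, σ']`, at some positive radius depending on `s`, then it is flat near all of them at one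
common positive radius (compactness of `[σ, σ']`, continuity of the boundary parametrisation, and
stability of flatness under passing to nearby frontier points with half the radius). [folklore] -/
theorem exists_uniform_flatRadius : ∀ (R : ConformalRectangle) {σ σ' : ℝ}
    (h : ∀ s ∈ Icc σ σ', ∃ r : ℝ, 0 < r ∧
      ((∀ z' ∈ frontier R.carrier, dist z' (R.boundary s) < r → z'.im = (R.boundary s).im) ∨
        (∀ z' ∈ frontier R.carrier, dist z' (R.boundary s) < r → z'.re = (R.boundary s).re))),
    ∃ r : ℝ, 0 < r ∧ ∀ s ∈ Icc σ σ',
      ((∀ z' ∈ frontier R.carrier, dist z' (R.boundary s) < r → z'.im = (R.boundary s).im) ∨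
        (∀ z' ∈ frontier R.carrier, dist z' (R.boundary s) < r → z'.re = (R.boundary s).re)) := by
  intro R σ σ' h
  classical
  -- a flat radius at every parameter (junk value `1` off the interval)
  have h' : ∀ s : ℝ, ∃ r : ℝ, 0 < r ∧ (s ∈ Icc σ σ' →
      ((∀ z' ∈ frontier R.carrier, dist z' (R.boundary s) < r → z'.im = (R.boundary s).im) ∨
        (∀ z' ∈ frontier R.carrier, dist z' (R.boundary s) < r → z'.re = (R.boundary s).re))) := by
    intro s
    by_cases hs : s ∈ Icc σ σ'
    · obtain ⟨r, hr, hf⟩ := h s hs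
      exact ⟨r, hr, fun _ => hf⟩
    · exact ⟨1, one_pos, fun h => (hs h).elim⟩
  choose r hr0 hr using h'
  -- finite subcover of the compact parameter interval by the pulled-back half-balls
  obtain ⟨t, ht, hcov⟩ := (isCompact_Icc : IsCompact (Icc σ σ')).elim_nhds_subcover
    (fun s => R.boundary ⁻¹' Metric.ball (R.boundary s) (r s / 2)) fun s _ =>
      (Metric.isOpen_ball.preimage R.continuous_boundary).mem_nhds
        (Metric.mem_ball_self (half_pos (hr0 s)))
  rcases t.eq_empty_or_nonempty with rfl | hne
  · refine ⟨1, one_pos, fun s hs => ?_⟩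
    simpa using hcov hs
  obtain ⟨s₀, hs₀, hmin⟩ := t.exists_min_image r hne
  refine ⟨r s₀ / 2, half_pos (hr0 s₀), fun s hs => ?_⟩
  obtain ⟨i, hi, hsi⟩ := mem_iUnion₂.1 (hcov hs)
  have hd : dist (R.boundary s) (R.boundary i) < r i / 2 := Metric.mem_ball.1 hsi
  have hri : r s₀ ≤ r i := hmin i hi
  have hfr : R.boundary s ∈ frontier R.carrier := R.boundary_mem_frontier s
  have hball : ∀ z' : ℂ, dist z' (R.boundary s) < r s₀ / 2 → dist z' (R.boundary i) < r i :=
    fun z' hdz =>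
    calc dist z' (R.boundary i) ≤ dist z' (R.boundary s) + dist (R.boundary s) (R.boundary i) :=
          dist_triangle _ _ _
      _ < r s₀ / 2 + r i / 2 := add_lt_add hdz hd
      _ ≤ r i := by linarith
  rcases hr i (ht i hi) with hflat | hflat
  · refine Or.inl fun z' hz' hdz => ?_
    rw [hflat z' hz' (hball z' hdz), hflat _ hfr (by linarith [hr0 i])]
  · refine Or.inr fun z' hz' hdz => ?_
    rw [hflat z' hz' (hball z' hdz), hflat _ hfr (by linarith [hr0 i])]

end Summit.CriticalPhenomena.CardyFormulaZ2.Cruxes.RectilinearCardy.ExcursionKernelCovariance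

end
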